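import Summits.BirchSwinnertonDyer.BirchSwinnertonDyer.Theorems.Rank2ObservatoryListedSpan
import HarnessLib

/-!
# BirchSwinnertonDyer — rank ≥ 2 observatory: `p`-saturation of the listed span (odd primes)

HONEST FRAMING: per-curve certified theorems and census instruments; no claim on BSD in rank ≥ 2.

`Rank2ObservatoryListedSpan.lean` proves, in the abstract, that the LISTED SPAN
`ℤP₁ + ℤP₂ + ℤP₃ + A_tors = AddSubgroup.closure {P₁, P₂, P₃} ⊔ AddCommGroup.torsion A` of three
points of an additive commutative group `A` (the Mordell–Weil group `E(ℚ)`) is `2`-SATURATED, from a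
torsion annihilator `2^u · m` (`m` odd) and seven coset witnesses. This file is the same algebra for
an ARBITRARY PRIME `p` — the abstract layer of the next kernel instrument (saturation of the listed
generators at the odd primes `3, 5, 7, …`; Siksek 1995 §3, Cremona 1997 §3.5): nothing below
mentions elliptic curves, and no statement introduces an auxiliary `Prop`.

* `pCoset B p u = p•B + B[p^u]` (an `AddSubgroup`; for `p = 2` it is `twoCoset B u` of
  `Rank2ObservatoryCosetWitness.lean`, restated rather than generalised in place so that the landed
  `2`-instrument is untouched), with `mem_pCoset_of_isCoprime_zsmul_mem` (multiples prime to `p`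
  are invertible modulo `pCoset`), `mem_pCoset_of_zsmul_eq_zero` (an element killed by `p^u · m`,
  `m` prime to `p`, lies in `pCoset`), and functoriality `map_mem_pCoset` /
  `not_mem_pCoset_of_map_not_mem` (pull a witness back along a reduction map);
* `not_mem_pCoset_of_residues` — if the `p³ − 1` residue combinations `aP₁ + bP₂ + cP₃`,
  `0 ≤ a, b, c < p` not all zero, avoid `pCoset A p u`, then so does every integer combination with
  a coefficient prime to `p` (subtract `p • (⌊a/p⌋P₁ + ⌊b/p⌋P₂ + ⌊c/p⌋P₃)`);
* `listedSpan_saturated_of_not_mem_pCoset` — under the annihilator hypothesis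
  (`(p^u · m) • t = 0` for every `t` of finite order, `m` prime to `p`) these witnesses give
  `∀ x, p • x ∈ span → x ∈ span`, i.e. the listed span is `p`-saturated; and
  `linearIndependent_triple_of_not_mem_pCoset` — they give `ℤ`-independence of `P₁, P₂, P₃`
  (descent on `|a| + |b| + |c|`);
* `not_dvd_index_listedSpan` / `finiteIndex_and_not_dvd_index_listedSpan` — in rank three
  (`Module.finrank ℤ A = 3`) the listed span then has finite index PRIME TO `p`
  (`SaturationSieve.not_dvd_index_of_isSaturatedAt`, Cauchy in the quotient; finiteness is the
  landed `finiteIndex_listedSpan`);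
* `not_mem_pCoset_zero_of_nsmul_ne_zero` — the WITNESS at a good prime: in a group `B` killed by
  `p · k` (for `B = Ẽ(𝔽_q)`: `p · k = #Ẽ(𝔽_q)`), an element `y` with `k • y ≠ 0` is not in
  `p•B = pCoset B p 0` (if `y = p • b` then `k • y = (p k) • b = 0`) — ONE scalar multiplication;
  soundness needs only `p ∣ #B`, exactness (`p ∥ #B`) matters only for finding witnesses;
* `saturated_map` — transport of `p`-saturation along an isomorphism (scaled model → census curve).

Sorry-free; no `decide`; axioms `propext`, `Classical.choice`, `Quot.sound` only.

References: S. Siksek, *Infinite descent on elliptic curves*, Rocky Mountain J. Math. 25 (1995)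
1501–1538, §3 (`p`-saturation via reduction modulo primes `q` with `p ∣ #Ẽ(𝔽_q)`); J. E. Cremona,
*Algorithms for Modular Elliptic Curves* (2nd ed. 1997), §3.5; M. Prickett, *Saturation of
Mordell–Weil groups of elliptic curves over number fields*, PhD thesis, Nottingham 2004.
-/

-- single-conjunct summit: `Summit.BirchSwinnertonDyer.BirchSwinnertonDyer.…` repeats the name
set_option linter.dupNamespace false

namespace Summit.BirchSwinnertonDyer.BirchSwinnertonDyer.Rank2Observatory

section Algebra

variable {A : Type*} [AddCommGroup A] {P₁ P₂ P₃ : A}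

/-! ### The subgroup `p•B + B[p^u]` -/

/-- `pCoset B p u = p•B + B[p^u]`: the elements `p • b + c` with `p^u • c = 0`. For `p = 2` this is
`twoCoset B u`. [cite: CremonaAlgorithms1997, §3.5] -/
def pCoset (B : Type*) [AddCommGroup B] (p u : ℕ) : AddSubgroup B where
  carrier := {y | ∃ b c : B, ((p : ℤ) ^ u) • c = 0 ∧ y = (p : ℤ) • b + c}
  add_mem' := by
    rintro _ _ ⟨b, c, hc, rfl⟩ ⟨b', c', hc', rfl⟩
    refine ⟨b + b', c + c', by rw [smul_add, hc, hc', add_zero], ?_⟩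
    rw [smul_add]
    abel
  zero_mem' := ⟨0, 0, by rw [smul_zero], by rw [smul_zero, add_zero]⟩
  neg_mem' := by
    rintro _ ⟨b, c, hc, rfl⟩
    exact ⟨-b, -c, by rw [smul_neg, hc, neg_zero], by rw [smul_neg, neg_add]⟩

/-- Membership in `pCoset`, definitionally. [folklore] -/
theorem mem_pCoset_iff {p u : ℕ} {y : A} :
    y ∈ pCoset A p u ↔ ∃ b c : A, ((p : ℤ) ^ u) • c = 0 ∧ y = (p : ℤ) • b + c :=
  Iff.rfl

/-- `p • b ∈ p•A + A[p^u]` (`ℤ`-multiple). [folklore] -/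
theorem natCast_zsmul_mem_pCoset (p u : ℕ) (b : A) : (p : ℤ) • b ∈ pCoset A p u :=
  ⟨b, 0, by rw [smul_zero], by rw [add_zero]⟩

/-- `p • b ∈ p•A + A[p^u]` (`ℕ`-multiple). [folklore] -/
theorem nsmul_mem_pCoset (p u : ℕ) (b : A) : p • b ∈ pCoset A p u := by
  rw [← natCast_zsmul]
  exact natCast_zsmul_mem_pCoset p u b

/-- **Multiples prime to `p` are invertible modulo `pCoset`**: if `a` is prime to `p` and
`a • x ∈ pCoset A p u` then `x ∈ pCoset A p u` (`x = α • (a • x) + p • (β • x)` for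
`α a + β p = 1`). [folklore] -/
theorem mem_pCoset_of_isCoprime_zsmul_mem {p u : ℕ} {a : ℤ} (ha : IsCoprime a p) {x : A}
    (h : a • x ∈ pCoset A p u) : x ∈ pCoset A p u := by
  obtain ⟨α, β, hαβ⟩ := ha
  have h1 : α * a + (p : ℤ) * β = 1 := by linear_combination hαβ
  have e : x = α • (a • x) + (p : ℤ) • (β • x) := by
    rw [smul_smul, smul_smul, ← add_smul, h1, one_smul]
  rw [e]
  exact add_mem (AddSubgroup.zsmul_mem _ h α) (natCast_zsmul_mem_pCoset p u (β • x))

/-- **An element killed by `p^u · m` with `m` prime to `p` lies in `p•A + A[p^u]`**: with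
`α m + β p = 1`, `x = p • (β • x) + α • (m • x)` and `p^u • (α • (m • x)) = α • ((p^u m) • x) = 0`.
[folklore] -/
theorem mem_pCoset_of_zsmul_eq_zero {p u : ℕ} {m : ℤ} (hm : IsCoprime m p) {x : A}
    (hx : ((p : ℤ) ^ u * m) • x = 0) : x ∈ pCoset A p u := by
  obtain ⟨α, β, hαβ⟩ := hm
  refine ⟨β • x, α • (m • x), ?_, ?_⟩
  · have e : (p : ℤ) ^ u * α * m = α * ((p : ℤ) ^ u * m) := by ring
    rw [smul_smul, smul_smul, e, mul_smul, hx, smul_zero]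
  · have h1 : (p : ℤ) * β + α * m = 1 := by linear_combination hαβ
    rw [smul_smul, smul_smul, ← add_smul, h1, one_smul]

/-- `m` prime to a prime `p`, from non-divisibility (the form a kernel certificate `decide`s).
[folklore] -/
theorem isCoprime_of_prime_of_not_dvd {p : ℕ} (hp : p.Prime) {m : ℤ} (hm : ¬ (p : ℤ) ∣ m) :
    IsCoprime m p :=
  ((Prime.coprime_iff_not_dvd (Nat.prime_iff_prime_int.mp hp)).mpr hm).symm

/-- `pCoset` is functorial: a homomorphism maps `p•A + A[p^u]` into `p•B + B[p^u]`. [folklore] -/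
theorem map_mem_pCoset {B : Type*} [AddCommGroup B] (φ : A →+ B) {p u : ℕ} {x : A}
    (hx : x ∈ pCoset A p u) : φ x ∈ pCoset B p u := by
  obtain ⟨b, c, hc, rfl⟩ := hx
  exact ⟨φ b, φ c, by rw [← map_zsmul, hc, map_zero], by rw [map_add, map_zsmul]⟩

/-- **Witness pull-back**: if `φ x ∉ p•B + B[p^u]` for some homomorphism `φ` (a reduction map
`E(ℚ) → Ẽ(𝔽_q)`), then `x ∉ p•A + A[p^u]`. [folklore] -/
theorem not_mem_pCoset_of_map_not_mem {B : Type*} [AddCommGroup B] (φ : A →+ B) {p u : ℕ}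
    {x : A} (h : φ x ∉ pCoset B p u) : x ∉ pCoset A p u :=
  fun hx => h (map_mem_pCoset φ hx)

/-- **The witness at a good prime.** In a group `B` killed by `p · k` (for `B = Ẽ(𝔽_q)`:
`p · k = #Ẽ(𝔽_q)`, Lagrange), an element `y` with `k • y ≠ 0` does not lie in
`p•B = pCoset B p 0`: if `y = p • b` then `k • y = (p k) • b = 0`. One scalar multiplication in
`Ẽ(𝔽_q)`; soundness uses only `p ∣ #B`. [folklore] -/
theorem not_mem_pCoset_zero_of_nsmul_ne_zero {B : Type*} [AddCommGroup B] {p k : ℕ} {y : B}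
    (hkill : ∀ b : B, (p * k) • b = 0) (hy : k • y ≠ 0) : y ∉ pCoset B p 0 := by
  rintro ⟨b, c, hc, rfl⟩
  rw [pow_zero, one_smul] at hc
  apply hy
  rw [hc, add_zero, natCast_zsmul, smul_smul, mul_comm, hkill]

/-! ### Residue reduction and `p`-saturation of the listed span -/

/-- **Residue reduction.** If the `p³ − 1` residue combinations `aP₁ + bP₂ + cP₃`
(`0 ≤ a, b, c < p`, not all zero) avoid `p•A + A[p^u]`, then so does `aP₁ + bP₂ + cP₃` for all
integers `a, b, c` not all divisible by `p` (subtract `p • (⌊a/p⌋P₁ + ⌊b/p⌋P₂ + ⌊c/p⌋P₃) ∈ p•A`).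
[cite: CremonaAlgorithms1997, §3.5] -/
theorem not_mem_pCoset_of_residues {p u : ℕ} (hp : 0 < p)
    (hw : ∀ a b c : ℤ, 0 ≤ a → a < p → 0 ≤ b → b < p → 0 ≤ c → c < p →
      ¬ (a = 0 ∧ b = 0 ∧ c = 0) → a • P₁ + b • P₂ + c • P₃ ∉ pCoset A p u)
    {a b c : ℤ} (hdiv : ¬ ((p : ℤ) ∣ a ∧ (p : ℤ) ∣ b ∧ (p : ℤ) ∣ c)) :
    a • P₁ + b • P₂ + c • P₃ ∉ pCoset A p u := by
  intro hx
  have hp' : (0 : ℤ) < p := by exact_mod_cast hp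
  obtain ⟨qa, ra, hra, hra', rfl⟩ : ∃ q r : ℤ, 0 ≤ r ∧ r < p ∧ a = (p : ℤ) * q + r :=
    ⟨a / p, a % p, Int.emod_nonneg _ hp'.ne', Int.emod_lt_of_pos _ hp',
      by linear_combination -(Int.emod_add_ediv_mul a p)⟩
  obtain ⟨qb, rb, hrb, hrb', rfl⟩ : ∃ q r : ℤ, 0 ≤ r ∧ r < p ∧ b = (p : ℤ) * q + r :=
    ⟨b / p, b % p, Int.emod_nonneg _ hp'.ne', Int.emod_lt_of_pos _ hp',
      by linear_combination -(Int.emod_add_ediv_mul b p)⟩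
  obtain ⟨qc, rc, hrc, hrc', rfl⟩ : ∃ q r : ℤ, 0 ≤ r ∧ r < p ∧ c = (p : ℤ) * q + r :=
    ⟨c / p, c % p, Int.emod_nonneg _ hp'.ne', Int.emod_lt_of_pos _ hp',
      by linear_combination -(Int.emod_add_ediv_mul c p)⟩
  refine hw ra rb rc hra hra' hrb hrb' hrc hrc' ?_ ?_
  · rintro ⟨h1, h2, h3⟩
    subst h1 h2 h3
    exact hdiv ⟨by simp, by simp, by simp⟩
  · have e : ra • P₁ + rb • P₂ + rc • P₃ =
        ((p : ℤ) * qa + ra) • P₁ + ((p : ℤ) * qb + rb) • P₂ + ((p : ℤ) * qc + rc) • P₃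
          - (p : ℤ) • (qa • P₁ + qb • P₂ + qc • P₃) := by
      module
    rw [e]
    exact sub_mem hx (natCast_zsmul_mem_pCoset p u _)

/-- **Residue witnesses ⇒ the listed span is `p`-saturated.** Let `p` be prime, let every element
of finite order of `A` be killed by `p^u · m` with `m` prime to `p`, and let the residue
combinations `aP₁ + bP₂ + cP₃` (`0 ≤ a, b, c < p`, not all zero) lie outside `p•A + A[p^u]`. If
`p • x` lies in the listed span then so does `x`: writing `p • x − (aP₁ + bP₂ + cP₃) = t` of finite
order, a coefficient prime to `p` would put `aP₁ + bP₂ + cP₃ = p • x − t` in `p•A + A[p^u]`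
(`t ∈ pCoset` by `mem_pCoset_of_zsmul_eq_zero`), against `not_mem_pCoset_of_residues`; so `p`
divides `a, b, c` and `x − ((a/p)P₁ + (b/p)P₂ + (c/p)P₃)` has finite order (its `p`-th multiple is
`t`). Siksek 1995 §3. [cite: CremonaAlgorithms1997, §3.5] -/
theorem listedSpan_saturated_of_not_mem_pCoset {p u : ℕ} (hp : p.Prime) {m : ℤ}
    (hm : IsCoprime m p) (htors : ∀ x : A, IsOfFinAddOrder x → ((p : ℤ) ^ u * m) • x = 0)
    (hw : ∀ a b c : ℤ, 0 ≤ a → a < p → 0 ≤ b → b < p → 0 ≤ c → c < p →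
      ¬ (a = 0 ∧ b = 0 ∧ c = 0) → a • P₁ + b • P₂ + c • P₃ ∉ pCoset A p u) :
    ∀ x : A, p • x ∈ AddSubgroup.closure {P₁, P₂, P₃} ⊔ AddCommGroup.torsion A →
      x ∈ AddSubgroup.closure {P₁, P₂, P₃} ⊔ AddCommGroup.torsion A := by
  intro x hx
  obtain ⟨a, b, c, habc⟩ := mem_listedSpan_iff.mp hx
  rw [← natCast_zsmul] at habc
  by_cases hdiv : (p : ℤ) ∣ a ∧ (p : ℤ) ∣ b ∧ (p : ℤ) ∣ c
  · obtain ⟨⟨a', rfl⟩, ⟨b', rfl⟩, ⟨c', rfl⟩⟩ := hdiv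
    refine mem_listedSpan_iff.mpr ⟨a', b', c', ?_⟩
    have e : (p : ℤ) • x - (((p : ℤ) * a') • P₁ + ((p : ℤ) * b') • P₂ + ((p : ℤ) * c') • P₃) =
        (p : ℤ) • (x - (a' • P₁ + b' • P₂ + c' • P₃)) := by
      module
    rw [e, natCast_zsmul] at habc
    exact habc.of_nsmul hp.ne_zero
  · exfalso
    have ht : (p : ℤ) • x - (a • P₁ + b • P₂ + c • P₃) ∈ pCoset A p u :=
      mem_pCoset_of_zsmul_eq_zero hm (htors _ habc)
    have e : a • P₁ + b • P₂ + c • P₃ =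
        (p : ℤ) • x - ((p : ℤ) • x - (a • P₁ + b • P₂ + c • P₃)) := by
      abel
    refine not_mem_pCoset_of_residues hp.pos hw hdiv ?_
    rw [e]
    exact sub_mem (natCast_zsmul_mem_pCoset p u x) ht

/-- **Residue witnesses ⇒ `ℤ`-independence of three points** (descent on `|a| + |b| + |c|`: a
combination of finite order with all coefficients divisible by `p` is `p` times a smaller one of
finite order; one with a coefficient prime to `p` is killed by `p^u m`, so lies in `p•A + A[p^u]`,
contradicting the residue reduction). [cite: CremonaAlgorithms1997, §3.5] -/
theorem linearIndependent_triple_of_not_mem_pCoset {p u : ℕ} (hp : p.Prime) {m : ℤ}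
    (hm : IsCoprime m p) (htors : ∀ x : A, IsOfFinAddOrder x → ((p : ℤ) ^ u * m) • x = 0)
    (hw : ∀ a b c : ℤ, 0 ≤ a → a < p → 0 ≤ b → b < p → 0 ≤ c → c < p →
      ¬ (a = 0 ∧ b = 0 ∧ c = 0) → a • P₁ + b • P₂ + c • P₃ ∉ pCoset A p u) :
    LinearIndependent ℤ ![P₁, P₂, P₃] := by
  -- a combination of finite order has zero coefficients (descent on the size of the coefficients)
  have key : ∀ n : ℕ, ∀ a b c : ℤ, a.natAbs + b.natAbs + c.natAbs ≤ n →
      IsOfFinAddOrder (a • P₁ + b • P₂ + c • P₃) → a = 0 ∧ b = 0 ∧ c = 0 := by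
    intro n
    induction n with
    | zero =>
      intro a b c hn _
      have ha : a.natAbs = 0 := by omega
      have hb : b.natAbs = 0 := by omega
      have hc : c.natAbs = 0 := by omega
      exact ⟨Int.natAbs_eq_zero.mp ha, Int.natAbs_eq_zero.mp hb, Int.natAbs_eq_zero.mp hc⟩
    | succ n ih =>
      intro a b c hn hfin
      by_cases hdiv : (p : ℤ) ∣ a ∧ (p : ℤ) ∣ b ∧ (p : ℤ) ∣ c
      · obtain ⟨⟨a', rfl⟩, ⟨b', rfl⟩, ⟨c', rfl⟩⟩ := hdiv
        rw [Int.natAbs_mul, Int.natAbs_mul, Int.natAbs_mul, Int.natAbs_natCast] at hn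
        have e : ((p : ℤ) * a') • P₁ + ((p : ℤ) * b') • P₂ + ((p : ℤ) * c') • P₃ =
            (p : ℤ) • (a' • P₁ + b' • P₂ + c' • P₃) := by
          module
        rw [e, natCast_zsmul] at hfin
        have h1 : 2 * (a'.natAbs + b'.natAbs + c'.natAbs) ≤
            p * (a'.natAbs + b'.natAbs + c'.natAbs) := Nat.mul_le_mul_right _ hp.two_le
        have h2 : p * (a'.natAbs + b'.natAbs + c'.natAbs) ≤ n + 1 := by
          calc p * (a'.natAbs + b'.natAbs + c'.natAbs)
              = p * a'.natAbs + p * b'.natAbs + p * c'.natAbs := by ring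
            _ ≤ n + 1 := hn
        have h3 : 2 * (a'.natAbs + b'.natAbs + c'.natAbs) ≤ n + 1 := le_trans h1 h2
        have h := ih a' b' c' (by omega) (hfin.of_nsmul hp.ne_zero)
        obtain ⟨rfl, rfl, rfl⟩ := h
        exact ⟨by rw [mul_zero], by rw [mul_zero], by rw [mul_zero]⟩
      · exact absurd (mem_pCoset_of_zsmul_eq_zero hm (htors _ hfin))
          (not_mem_pCoset_of_residues hp.pos hw hdiv)
  rw [Fintype.linearIndependent_iff]
  intro g hg i
  simp only [Fin.sum_univ_three, Matrix.cons_val_zero, Matrix.cons_val_one, Matrix.cons_val_two,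
    Matrix.head_cons, Matrix.tail_cons] at hg
  have h0 := key _ (g 0) (g 1) (g 2) le_rfl (by rw [hg]; exact IsOfFinAddOrder.zero)
  fin_cases i
  · exact h0.1
  · exact h0.2.1
  · exact h0.2.2

/-! ### Index prime to `p` in rank three -/

/-- **Index prime to `p`**: a `p`-saturated listed span of finite index has index prime to `p`
(`SaturationSieve.not_dvd_index_of_isSaturatedAt`, Cauchy in the quotient).
[cite: CremonaAlgorithms1997, §3.5] -/
theorem not_dvd_index_listedSpan {p : ℕ} (hp : p.Prime)
    [(AddSubgroup.closure {P₁, P₂, P₃} ⊔ AddCommGroup.torsion A).FiniteIndex]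
    (hsat : ∀ x : A, p • x ∈ AddSubgroup.closure {P₁, P₂, P₃} ⊔ AddCommGroup.torsion A →
      x ∈ AddSubgroup.closure {P₁, P₂, P₃} ⊔ AddCommGroup.torsion A) :
    ¬ p ∣ (AddSubgroup.closure {P₁, P₂, P₃} ⊔ AddCommGroup.torsion A).index :=
  SaturationSieve.not_dvd_index_of_isSaturatedAt _ hp hsat

/-- **Summary in rank three, prime `p`**: annihilator `p^u · m` + the `p³ − 1` residue witnesses +
`finrank = 3` give a listed span of finite index PRIME TO `p` (`ℤ`-independence from
`linearIndependent_triple_of_not_mem_pCoset`, finiteness from the landed `finiteIndex_listedSpan`,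
coprimality from `p`-saturation): `p` does not divide the index `n` in
`Reg(P) = n² · Reg(A/A_tors)`.
[cite: CremonaAlgorithms1997, §3.5] -/
theorem finiteIndex_and_not_dvd_index_listedSpan [Module.Finite ℤ A]
    (hr : Module.finrank ℤ A = 3) {p u : ℕ} (hp : p.Prime) {m : ℤ} (hm : IsCoprime m p)
    (htors : ∀ x : A, IsOfFinAddOrder x → ((p : ℤ) ^ u * m) • x = 0)
    (hw : ∀ a b c : ℤ, 0 ≤ a → a < p → 0 ≤ b → b < p → 0 ≤ c → c < p →
      ¬ (a = 0 ∧ b = 0 ∧ c = 0) → a • P₁ + b • P₂ + c • P₃ ∉ pCoset A p u) :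
    (AddSubgroup.closure {P₁, P₂, P₃} ⊔ AddCommGroup.torsion A).FiniteIndex ∧
      ¬ p ∣ (AddSubgroup.closure {P₁, P₂, P₃} ⊔ AddCommGroup.torsion A).index := by
  haveI := finiteIndex_listedSpan hr (linearIndependent_triple_of_not_mem_pCoset hp hm htors hw)
  exact ⟨this, not_dvd_index_listedSpan hp
    (listedSpan_saturated_of_not_mem_pCoset hp hm htors hw)⟩

/-! ### Transport along an isomorphism -/

variable {B : Type*} [AddCommGroup B]

/-- `p`-saturation of the listed span is transported by an isomorphism `e : A ≃+ B` (to move a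
certificate from a scaled integral model to the census equation). [folklore] -/
theorem saturated_map (e : A ≃+ B) (p : ℕ)
    (hsat : ∀ x : A, p • x ∈ AddSubgroup.closure {P₁, P₂, P₃} ⊔ AddCommGroup.torsion A →
      x ∈ AddSubgroup.closure {P₁, P₂, P₃} ⊔ AddCommGroup.torsion A) :
    ∀ y : B, p • y ∈ AddSubgroup.closure {e P₁, e P₂, e P₃} ⊔ AddCommGroup.torsion B →
      y ∈ AddSubgroup.closure {e P₁, e P₂, e P₃} ⊔ AddCommGroup.torsion B := by
  intro y hy
  rw [mem_listedSpan_map_iff] at hy ⊢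
  rw [map_nsmul] at hy
  exact hsat _ hy

end Algebra

end Summit.BirchSwinnertonDyer.BirchSwinnertonDyer.Rank2Observatory
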